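import Summits.PneNP.PneNP.Theorems.SzkEntropyPeaWorstToAvgDualModeCompileCompilePerf
import Literature.Computability.Complexity.PEADegreeReduction

/-!
# Route SzkEntropy, crux `PeaWorstToAvg` (stmt-PneNP-10777), line `dual-mode-compile`: stub `stub_compile` —
# the Applebaum–Ishai–Kushilevitz compile `BPEA ≤ₚ PEA 3` (polynomial time and assembly)

Closing file of stub `stub_compile` of the skeleton `Cruxes/PeaWorstToAvg/Lines/dual-mode-compile.lean`:
entropy approximation for multi-output AFFINE PARITY BRANCHING PROGRAMS (`BPEA`, gap `1` at integer thresholds)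
Karp-reduces to entropy approximation for CUBIC sparse polynomial maps over `F₂` (`PEA 3`), by the perfect degree-3
randomizing polynomials of a branching program [Ishai–Kushilevitz 2002, §3; Applebaum–Ishai–Kushilevitz 2006, §4.2]:
`⟨ℓ, (F, k)⟩ ↦ ⟨ℓ + s, (p̂, k + s)⟩` where `p̂` lists, for each output program `P` of `F`, the entries on and above the
diagonal of `R₁ · L_P(x) · R₂` in `s` fresh variables (files I–II: `symHess`, `blockBP`, `compileAux`,
`compileInst`), so that `H(p̂(U_{ℓ+s})) = H(F(U_ℓ)) + s` exactly and `deg p̂ ≤ 3` (file II).  Here: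

§1 the closed form `compileAux_eq` of the compiled map (by the prefix sums `prefixFresh`) and the compile as a `CodeFP`
program (the tree's typed polynomial-time algebra, assembled from `map`/`filter`/`flatten` with contexts and binary
arithmetic exactly as `DegreeThreeEncodingFP/MapFP.lean` do for `RandPoly.encodeMap`): `codeFP_symLab`,
`codeFP_symHess`, `codeFP_entryOfHess`, `codeFP_blockOfHess`, `codeFP_blockBP`, `codeFP_compileAux_snd/fst`, and the
raw instance map `codeFP_compileRaw` between the tuple codes of `BPEA` and `PEA` instances;
§2 `compile_encode_eq_bpeaE` (the code of a `BPEA` instance is the tuple code of `(ℓ, natBPs F, k)`), `rawOf_compileInst`,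
and the registered `stub_compile : (hblock : …) → BPEA.PolyTimeReducible (PEA 3)` (assembled as the tree's
`RandPoly.PEA_polyTimeReducible_three`).

The one-block perfectness (the valuation-level Ishai–Kushilevitz lemma for a general unit-lower-Hessenberg symbolic
matrix) is NOT proved here: it is the hypothesis `hblock` of the registered signature, the statement of the sibling
stub `stub_blockPerf`.

References: Y. Ishai, E. Kushilevitz, ICALP 2002, §3; B. Applebaum, Y. Ishai, E. Kushilevitz, SIAM J. Comput. 36
(2006), §4.2; Z. Dvir, D. Gutfreund, G. Rothblum, S. Vadhan, ICS 2011, Thm. 4.5–4.6; S. Arora, B. Barak,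
*Computational Complexity: A Modern Approach*, CUP 2009, §1.3; O. Goldreich, *On promise problems* (2006), Def. 1.4.
-/

namespace Summit.PneNP.PneNP.Cruxes.PeaWorstToAvg.DualModeCompile

open _root_.Computability
open Literature.Computability.Complexity
open Literature.Computability.Complexity.CodeFP (natE pairE rawE listE bitE unE)
open Literature.Computability.Complexity.RandPoly (mulP pos pairsLE symR1 symR2 codeFP_pos codeFP_symR1
  codeFP_symR2 codeFP_mulP codeFP_rhoPoly codeFP_takeNat natOf natOf_toFinMap listE_comp)

set_option linter.dupNamespace false -- `Summit.PneNP.PneNP.…`: summit = sub-problem name (D-0017 single-conjunct layout)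

/-! ### Closed form of the counter and of the compiled map -/

/-- `prefixFresh` at `0`. [folklore] -/
@[simp] theorem prefixFresh_zero (Ps : List (List (List (Bool × List ℕ)))) : prefixFresh Ps 0 = 0 := by
  simp [prefixFresh]

/-- `prefixFresh` of a cons, one step. [folklore] -/
theorem prefixFresh_cons_succ (P : List (List (Bool × List ℕ))) (Ps : List (List (List (Bool × List ℕ)))) (i : ℕ) :
    prefixFresh (P :: Ps) (i + 1) = freshBP P + prefixFresh Ps i := by
  simp only [prefixFresh, List.take_succ_cons, List.map_cons, List.sum_cons]

/-- **Closed form of `compileAux`**: counter `n + prefixFresh Ps |Ps|`, outputs the blocks of the programs at the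
prefix counters. [folklore] -/
theorem compileAux_eq (n : ℕ) (Ps : List (List (List (Bool × List ℕ)))) :
    compileAux n Ps = (n + prefixFresh Ps Ps.length,
      (List.range Ps.length).flatMap fun i => blockBP (n + prefixFresh Ps i) (Ps.getD i [])) := by
  induction Ps generalizing n with
  | nil => simp [compileAux, prefixFresh]
  | cons P Ps ih =>
    rw [show compileAux n (P :: Ps) = ((compileAux (n + freshBP P) Ps).1,
      blockBP n P ++ (compileAux (n + freshBP P) Ps).2) from rfl, ih]
    refine Prod.ext ?_ ?_
    · show n + freshBP P + prefixFresh Ps Ps.length = n + prefixFresh (P :: Ps) (Ps.length + 1)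
      rw [prefixFresh_cons_succ, Nat.add_assoc]
    · show blockBP n P ++ _ = _
      rw [List.length_cons, RandPoly.flatMap_range_succ, prefixFresh_zero, Nat.add_zero, List.getD_cons_zero]
      congr 1
      exact List.flatMap_congr fun i _ => by rw [List.getD_cons_succ, prefixFresh_cons_succ, Nat.add_assoc]

/-! ### The compile on codes -/

-- The specification functions are only ever REWRITTEN with their closed forms below; keeping them irreducible stops
-- the unifier from unfolding them while matching the composed programs (as in `DegreeThreeEncodingMapFP.lean`).
attribute [local irreducible] blockOf compileAux

/-- The raw code of presented programs (rows of labels `(bit, list of variable indices)`). -/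
local notation "progE" => (rawE (rawE (pairE bitE (rawE natE))) : List (List (Bool × List ℕ)) → List Bool)

/-! ### The symbolic label and matrix -/

/-- `symLab` on codes. [cite: AroraBarak2009, §1.3] -/
theorem codeFP_symLab : CodeFP (pairE bitE (rawE natE)) (rawE (rawE natE)) symLab :=
  ((CodeFP.rawAppend (rawE natE)).comp (((CodeFP.fst bitE (rawE natE)).ite (CodeFP.const _ [[]])
    (CodeFP.const _ [])).pair (codeFP_rhoPoly.comp (CodeFP.snd bitE (rawE natE))))).congr fun _ => rfl

/-- The range `[0, d]` of matrix indices, `d = |l| - 1` (`d + 1` in binary, converted to unary under the budget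
`|l| + 1`; the tree's `RandPoly.codeFP_rangeDim` for an arbitrary item code). [folklore] -/
theorem compile_codeFP_rangeDim {α : Type} (eα : α → List Bool) :
    CodeFP (rawE eα) (rawE natE) (fun l => List.range (l.length - 1 + 1)) := by
  have hb : CodeFP (rawE eα) natE (fun l => l.length - 1 + 1) :=
    CodeFP.natAdd.comp ((CodeFP.natSub.comp ((CodeFP.natLength eα).pair (CodeFP.const _ 1))).pair
      (CodeFP.const _ 1))
  have hu : CodeFP (rawE eα) unE (fun l => min (l.length - 1 + 1) (l.length + 1)) :=
    CodeFP.unOfNatMin.comp ((CodeFP.unSucc.comp (CodeFP.ulength eα)).pair hb)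
  exact (CodeFP.urange.comp hu).congr fun l => by rw [min_eq_left (by omega)]

/-- **`symHess P j l` on codes** (argument `(P, j, l)`; the label is looked up in the row mapped through `symLab`,
whose default `symLab 0 = []` is coded by `ε`). [cite: AroraBarak2009, §1.3] -/
theorem codeFP_symHess : CodeFP (pairE progE (pairE natE natE)) (rawE (rawE natE)) (fun c => symHess c.1 c.2.1 c.2.2) := by
  let cE := pairE progE (pairE natE natE)
  have hP : CodeFP cE progE (fun c => c.1) := CodeFP.fst _ _
  have hJ : CodeFP cE natE (fun c => c.2.1) := (CodeFP.snd _ _).fst'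
  have hL : CodeFP cE natE (fun c => c.2.2) := (CodeFP.snd _ _).snd'
  have hrow : CodeFP cE (rawE (rawE (rawE natE))) (fun c => (c.1.getD c.2.1 []).map symLab) :=
    (CodeFP.map₀ codeFP_symLab).comp ((CodeFP.rawGetD (rawE (pairE bitE (rawE natE))) (d := []) rfl).comp (hP.pair hJ))
  have hlab0 : CodeFP cE (rawE (rawE natE)) (fun c => ((c.1.getD c.2.1 []).map symLab).getD (c.2.2 - c.2.1) []) :=
    (CodeFP.rawGetD (rawE (rawE natE)) (d := []) rfl).comp (hrow.pair (CodeFP.natSub.comp (hL.pair hJ)))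
  have hlab : CodeFP cE (rawE (rawE natE)) (fun c => symLab ((c.1.getD c.2.1 []).getD (c.2.2 - c.2.1) (false, []))) :=
    hlab0.congr fun c => by rw [show ([] : List (List ℕ)) = symLab (false, []) from rfl, List.getD_map]
  refine ((CodeFP.natLe.comp (hJ.pair hL)).ite hlab ((CodeFP.natEq.comp (hJ.pair (CodeFP.natAdd.comp
    (hL.pair (CodeFP.const _ 1))))).ite (CodeFP.const _ [[]]) (CodeFP.const _ []))).congr fun c => ?_
  simp only [symHess, decide_eq_true_eq]

/-! ### Entries and the block -/

/-- `entryOf n₀ d (symHess P) i k` on codes, `d = |P| - 1` (argument `((n₀, P), i, k)`). [cite: AroraBarak2009, §1.3] -/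
theorem codeFP_entryOfHess :
    CodeFP (pairE (pairE natE progE) (pairE natE natE)) (rawE (rawE natE))
      (fun c => entryOf c.1.1 (c.1.2.length - 1) (symHess c.1.2) c.2.1 c.2.2) := by
  let cE := pairE (pairE natE progE) (pairE natE natE)
  -- the summand `R₁[i,j] · Lsym[j,l] · R₂[l,k]` on `((c, j), l)`
  let c3E := pairE (pairE cE natE) natE
  have hN : CodeFP c3E natE (fun c => c.1.1.1.1) := (CodeFP.fst _ _).fst'.fst'.fst'
  have hP : CodeFP c3E progE (fun c => c.1.1.1.2) := (CodeFP.fst _ _).fst'.fst'.snd'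
  have hD : CodeFP c3E natE (fun c => c.1.1.1.2.length - 1) :=
    CodeFP.natSub.comp (((CodeFP.natLength _).comp hP).pair (CodeFP.const _ 1))
  have hI : CodeFP c3E natE (fun c => c.1.1.2.1) := (CodeFP.fst _ _).fst'.snd'.fst'
  have hK : CodeFP c3E natE (fun c => c.1.1.2.2) := (CodeFP.fst _ _).fst'.snd'.snd'
  have hJ : CodeFP c3E natE (fun c => c.1.2) := (CodeFP.fst _ _).snd'
  have hL : CodeFP c3E natE (fun c => c.2) := CodeFP.snd _ _
  have hR1 := codeFP_symR1.comp (hN.pair (hI.pair hJ))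
  have hLs := codeFP_symHess.comp (hP.pair (hJ.pair hL))
  have hR2 := codeFP_symR2.comp ((hN.pair hD).pair (hL.pair hK))
  have hsum : CodeFP c3E (rawE (rawE natE)) (fun c => mulP (mulP (symR1 c.1.1.1.1 c.1.1.2.1 c.1.2)
      (symHess c.1.1.1.2 c.1.2 c.2)) (symR2 c.1.1.1.1 (c.1.1.1.2.length - 1) c.2 c.1.1.2.2)) :=
    (codeFP_mulP.comp ((codeFP_mulP.comp (hR1.pair hLs)).pair hR2)).congr fun _ => rfl
  have hrange : CodeFP cE (rawE natE) (fun c => List.range (c.1.2.length - 1 + 1)) :=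
    (compile_codeFP_rangeDim _).comp (CodeFP.fst _ _).snd'
  -- the inner sum over `l` with context `(c, j)`
  have hinner : CodeFP (pairE cE natE) (rawE (rawE natE)) (fun c => (List.range (c.1.1.2.length - 1 + 1)).flatMap
      fun l => mulP (mulP (symR1 c.1.1.1 c.1.2.1 c.2) (symHess c.1.1.2 c.2 l))
        (symR2 c.1.1.1 (c.1.1.2.length - 1) l c.1.2.2)) :=
    ((CodeFP.flatten (rawE natE)).comp ((CodeFP.map (σ := ((ℕ × List (List (Bool × List ℕ))) × ℕ × ℕ) × ℕ)
      (α := ℕ) hsum).comp ((CodeFP.id (pairE cE natE)).pair (hrange.comp (CodeFP.fst _ _))))).congr fun c => by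
        rw [List.flatMap_def]; rfl
  -- the outer sum over `j`
  exact ((CodeFP.flatten (rawE natE)).comp ((CodeFP.map (σ := (ℕ × List (List (Bool × List ℕ))) × ℕ × ℕ) (α := ℕ)
    hinner).comp ((CodeFP.id cE).pair hrange))).congr fun c => by
      rw [entryOf, List.flatMap_def]; rfl

/-- `pairsLE (|l| - 1)` on codes (the tree's `RandPoly.codeFP_pairsLE` for an arbitrary item code). [cite: AroraBarak2009, §1.3] -/
theorem compile_codeFP_pairsLE {α : Type} (eα : α → List Bool) :
    CodeFP (rawE eα) (rawE (pairE natE natE)) (fun l => pairsLE (l.length - 1)) := by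
  have hle : CodeFP (pairE natE natE) bitE (fun q => decide (q.1 ≤ q.2)) := CodeFP.natLe
  have hrow : CodeFP (pairE (rawE eα) natE) (rawE (pairE natE natE))
      (fun c => ((List.range (c.1.length - 1 + 1)).filter fun k => decide (c.2 ≤ k)).map fun k => (c.2, k)) := by
    have hfilt : CodeFP (pairE (rawE eα) natE) (rawE natE)
        (fun c => (List.range (c.1.length - 1 + 1)).filter fun k => decide (c.2 ≤ k)) :=
      (CodeFP.filter (σ := List α × ℕ) (α := ℕ) (hle.comp ((CodeFP.fst _ _).snd'.pair (CodeFP.snd _ _)))).comp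
        ((CodeFP.id _).pair ((compile_codeFP_rangeDim eα).comp (CodeFP.fst _ _)))
    exact (CodeFP.map (σ := List α × ℕ) (α := ℕ) ((CodeFP.fst _ _).snd'.pair (CodeFP.snd _ _))).comp
      ((CodeFP.id _).pair hfilt)
  exact ((CodeFP.flatten (pairE natE natE)).comp ((CodeFP.map (σ := List α) (α := ℕ) hrow).comp
    ((CodeFP.id (rawE eα)).pair (compile_codeFP_rangeDim eα)))).congr fun l => by
      rw [pairsLE, List.flatMap_def]; rfl

/-- **`blockOf n₀ d (symHess P)`, `d = |P| - 1`, on codes** (argument `(n₀, P)`). [cite: AroraBarak2009, §1.3] -/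
theorem codeFP_blockOfHess :
    CodeFP (pairE natE progE) (rawE (rawE (rawE natE))) (fun c => blockOf c.1 (c.2.length - 1) (symHess c.2)) :=
  ((CodeFP.map (σ := ℕ × List (List (Bool × List ℕ))) (α := ℕ × ℕ) codeFP_entryOfHess).comp
    ((CodeFP.id (pairE natE progE)).pair ((compile_codeFP_pairsLE _).comp (CodeFP.snd _ _)))).congr fun c => by
      rw [blockOf]; rfl

/-- **The block of one program on codes** (argument `(n, P)`). [cite: AroraBarak2009, §1.3] -/
theorem codeFP_blockBP : CodeFP (pairE natE progE) (rawE (rawE (rawE natE))) (fun c => blockBP c.1 c.2) :=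
  (((CodeFP.rawIsEmpty _).comp (CodeFP.snd natE progE)).ite (CodeFP.const _ [[[]]]) codeFP_blockOfHess).congr
    fun _ => rfl

/-- The number of fresh variables of one program on codes. [cite: AroraBarak2009, §1.3] -/
theorem codeFP_freshBP : CodeFP progE natE freshBP := by
  have hd : CodeFP progE natE (fun P => P.length - 1) :=
    CodeFP.natSub.comp ((CodeFP.natLength _).pair (CodeFP.const _ 1))
  exact ((CodeFP.rawIsEmpty _).ite (CodeFP.const _ 0) (codeFP_pos.comp (hd.pair hd))).congr fun _ => rfl

/-! ### The compiled map (closed form) -/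

/-- `prefixFresh Ps i` on codes (argument `(Ps, i)`). [cite: AroraBarak2009, §1.3] -/
theorem codeFP_prefixFresh : CodeFP (pairE (rawE progE) natE) natE (fun c => prefixFresh c.1 c.2) :=
  (CodeFP.natSum.comp ((CodeFP.map₀ codeFP_freshBP).comp ((codeFP_takeNat progE).comp
    ((CodeFP.snd _ _).pair (CodeFP.fst _ _))))).congr fun _ => rfl

/-- **`(compileAux n Ps).2` on codes** (argument `(n, Ps)`). [cite: AroraBarak2009, §1.3] -/
theorem codeFP_compileAux_snd :
    CodeFP (pairE natE (rawE progE)) (rawE (rawE (rawE natE))) (fun c => (compileAux c.1 c.2).2) := by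
  let cE := pairE natE (rawE progE)
  have hC : CodeFP (pairE cE natE) natE (fun c => c.1.1 + prefixFresh c.1.2 c.2) :=
    CodeFP.natAdd.comp ((CodeFP.fst _ _).fst'.pair (codeFP_prefixFresh.comp ((CodeFP.fst _ _).snd'.pair (CodeFP.snd _ _))))
  have hG : CodeFP (pairE cE natE) progE (fun c => c.1.2.getD c.2 []) :=
    (CodeFP.rawGetD progE (d := []) rfl).comp ((CodeFP.fst _ _).snd'.pair (CodeFP.snd _ _))
  have hitem : CodeFP (pairE cE natE) (rawE (rawE (rawE natE)))
      (fun c => blockBP (c.1.1 + prefixFresh c.1.2 c.2) (c.1.2.getD c.2 [])) :=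
    codeFP_blockBP.comp (hC.pair hG)
  have hrange : CodeFP cE (rawE natE) (fun c => List.range c.2.length) :=
    CodeFP.urange.comp ((CodeFP.ulength progE).comp (CodeFP.snd _ _))
  have hall : CodeFP cE (rawE (rawE (rawE natE))) (fun c => ((List.range c.2.length).map fun i =>
      blockBP (c.1 + prefixFresh c.2 i) (c.2.getD i [])).flatten) :=
    (CodeFP.flatten (rawE (rawE natE))).comp ((CodeFP.map (σ := ℕ × List (List (List (Bool × List ℕ)))) (α := ℕ)
      hitem).comp ((CodeFP.id cE).pair hrange))
  exact hall.congr fun c => by rw [compileAux_eq, List.flatMap_def]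

/-- **`(compileAux n Ps).1` on codes** (argument `(n, Ps)`). [cite: AroraBarak2009, §1.3] -/
theorem codeFP_compileAux_fst : CodeFP (pairE natE (rawE progE)) natE (fun c => (compileAux c.1 c.2).1) :=
  (CodeFP.natAdd.comp ((CodeFP.fst _ _).pair (codeFP_prefixFresh.comp ((CodeFP.snd _ _).pair
    ((CodeFP.natLength progE).comp (CodeFP.snd _ _)))))).congr fun c => by rw [compileAux_eq]

/-! ### The raw instance map between the codes of `BPEA` and `PEA` instances -/

/-- Headed programs (the format of `AffBPMap.encoding`, over ℕ) to raw programs. [folklore] -/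
theorem codeFP_progsRaw :
    CodeFP (listE (listE (listE (pairE bitE (listE natE))))) (rawE progE) id := by
  have hlab : CodeFP (pairE bitE (listE natE)) (pairE bitE (rawE natE)) id :=
    ((CodeFP.fst _ _).pair ((CodeFP.rawOfList natE).comp (CodeFP.snd _ _))).congr fun _ => rfl
  have hrow : CodeFP (listE (pairE bitE (listE natE))) (rawE (pairE bitE (rawE natE))) id :=
    ((CodeFP.map₀ hlab).comp (CodeFP.rawOfList _)).congr fun l => by simp
  have hprog : CodeFP (listE (listE (pairE bitE (listE natE)))) progE id :=
    ((CodeFP.map₀ hrow).comp (CodeFP.rawOfList _)).congr fun l => by simp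
  exact ((CodeFP.map₀ hprog).comp (CodeFP.rawOfList _)).congr fun l => by simp

/-- Raw nested lists (three levels) to headed lists (the format of `PolyMapF2.encoding`, over ℕ). [folklore] -/
theorem codeFP_polyHead : CodeFP (rawE (rawE (rawE natE))) (listE (listE (listE natE))) id :=
  ((CodeFP.listOfRaw (listE (listE natE))).comp (CodeFP.map₀ ((CodeFP.listOfRaw (listE natE)).comp
    (CodeFP.map₀ (CodeFP.listOfRaw natE))))).congr fun P => by simp

/-- **The raw compile `(ℓ, Ps, k) ↦ (ℓ', p̂, k + (ℓ' - ℓ))`, `(ℓ', p̂) = compileAux ℓ Ps`, is typed polynomial time**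
between the tuple codes of `BPEA` instances (programs presented over ℕ) and of `PEA` instances.
[cite: AroraBarak2009, §1.3] -/
theorem codeFP_compileRaw :
    CodeFP (pairE natE (pairE (listE (listE (listE (pairE bitE (listE natE))))) natE))
      (pairE natE (pairE (listE (listE (listE natE))) natE))
      (fun c => ((compileAux c.1 c.2.1).1, (compileAux c.1 c.2.1).2, c.2.2 + ((compileAux c.1 c.2.1).1 - c.1))) := by
  let inE := pairE natE (pairE (listE (listE (listE (pairE bitE (listE natE))))) natE)
  have hN : CodeFP inE natE (fun c => c.1) := CodeFP.fst _ _
  have hP : CodeFP inE (rawE progE) (fun c => c.2.1) := (codeFP_progsRaw.comp (CodeFP.snd _ _).fst').congr fun _ => rfl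
  have hK : CodeFP inE natE (fun c => c.2.2) := (CodeFP.snd _ _).snd'
  have hN' : CodeFP inE natE (fun c => (compileAux c.1 c.2.1).1) := codeFP_compileAux_fst.comp (hN.pair hP)
  have hP' : CodeFP inE (listE (listE (listE natE))) (fun c => (compileAux c.1 c.2.1).2) :=
    (codeFP_polyHead.comp (codeFP_compileAux_snd.comp (hN.pair hP))).congr fun _ => rfl
  have hK' : CodeFP inE natE (fun c => c.2.2 + ((compileAux c.1 c.2.1).1 - c.1)) :=
    CodeFP.natAdd.comp (hK.pair (CodeFP.natSub.comp (hN'.pair hN)))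
  exact (hN'.pair (hP'.pair hK')).congr fun _ => rfl

/-! ### Codes of instances and the assembly -/

/-- Pair codes commute with maps of the second component. [folklore] -/
theorem compile_pairE_comp_snd {α β γ : Type} (e₁ : α → List Bool) (e₂ : γ → List Bool) (h : β → γ) :
    (pairE e₁ fun b => e₂ (h b)) = fun p : α × β => pairE e₁ e₂ (p.1, h p.2) := by
  funext p
  rfl

/-- **The code of a `BPEA` instance is the tuple code of `(ℓ, natBPs F, k)`** (labels' variable indices written as
naturals). [folklore] -/
theorem compile_encode_eq_bpeaE (I : BPEAInst) :
    BPEAInst.encoding.encode I =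
      pairE natE (pairE (listE (listE (listE (pairE bitE (listE natE))))) natE) (I.1, natBPs I.2.1, I.2.2) := by
  obtain ⟨ℓ, F, k⟩ := I
  show boolPair (encodeNat ℓ) (boolPair
      ((((encodingBoolBool.pairBool (encodingFinBool ℓ).listBool).listBool.listBool).listBool).encode F) (encodeNat k)) =
    boolPair (natE ℓ) (boolPair (listE (listE (listE (pairE bitE (listE natE)))) (natBPs F)) (natE k))
  rw [CodeFP.listE_eq, CodeFP.listE_eq, CodeFP.listE_eq, CodeFP.pairE_eq, CodeFP.listE_eq, CodeFP.bitE_eq]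
  have h1 : (listE (encodingFinBool ℓ).encode) = fun μ : List (Fin ℓ) => listE natE (μ.map Fin.val) :=
    listE_comp natE Fin.val
  have h2 : (pairE bitE fun μ : List (Fin ℓ) => listE natE (μ.map Fin.val)) =
      fun a : AffLabel ℓ => pairE bitE (listE natE) (natLab a) := compile_pairE_comp_snd bitE (listE natE) (List.map Fin.val)
  have h3 : (listE fun a : AffLabel ℓ => pairE bitE (listE natE) (natLab a)) =
      fun row => listE (pairE bitE (listE natE)) (row.map natLab) := listE_comp _ natLab
  have h4 : (listE fun row : List (AffLabel ℓ) => listE (pairE bitE (listE natE)) (row.map natLab)) =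
      fun P => listE (listE (pairE bitE (listE natE))) (P.map (List.map natLab)) := listE_comp _ (List.map natLab)
  have h5 : (listE fun P : AffBP ℓ => listE (listE (pairE bitE (listE natE))) (P.map (List.map natLab))) =
      fun F => listE (listE (listE (pairE bitE (listE natE)))) (F.map natBP) := listE_comp _ natBP
  rw [h1, h2, h3, h4, h5]
  rfl

/-- **The raw data of the compiled instance is the raw compile of the raw data.** [cite: ApplebaumIshaiKushilevitz2006, §4.2] -/
theorem rawOf_compileInst (I : BPEAInst) :
    ((compileInst I).1, natOf (compileInst I).2.1, (compileInst I).2.2) =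
      ((compileAux I.1 (natBPs I.2.1)).1, (compileAux I.1 (natBPs I.2.1)).2,
        I.2.2 + ((compileAux I.1 (natBPs I.2.1)).1 - I.1)) := by
  refine Prod.ext ?_ (Prod.ext ?_ ?_)
  · exact (compileAux_fst_eq I).symm
  · exact natOf_toFinMap _ _ _
  · show I.2.2 + freshOfI I = _
    rfl

/-- **STUB `stub_compile` · the Applebaum–Ishai–Kushilevitz compile `BPEA ≤ₚ PEA 3`** (Karp reduction of promise
problems), FROM the one-block perfectness `hblock` (= the statement of the sibling stub `stub_blockPerf`): on
`⟨ℓ, (F, k)⟩` output `⟨ℓ + s, (p̂, k + s)⟩`, `p̂` the degree-3 blocks of the output programs of `F` in `s` fresh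
variables; `H(p̂(U_{ℓ+s})) = H(F(U_ℓ)) + s` exactly, so YES ↦ YES and NO ↦ NO at the shifted integer threshold, and the
instance map is one `FP` function on codes. [cite: IshaiKushilevitz2002, §3] [cite: ApplebaumIshaiKushilevitz2006, §4.2]
[cite: DvirGutfreundRothblumVadhan2010, Thm. 4.5–4.6] [cite: Goldreich2006, Def. 1.4] -/
theorem stub_compile
    (hblock : ∀ (n₀ d : ℕ) (Lsym : ℕ → ℕ → List (List ℕ)),
      (∀ j l : ℕ, j = l + 1 → Lsym j l = [[]]) →
      (∀ j l : ℕ, l + 1 < j → Lsym j l = []) →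
      (∀ j l : ℕ, j ≤ l → ∀ μ ∈ Lsym j l, ∀ x ∈ μ, x < n₀) →
      RandPoly.PerfExt n₀ (n₀ + RandPoly.pos d d) (blockOf n₀ d Lsym)
        (fun v => (Matrix.of fun (j l : Fin (d + 1)) => RandPoly.evalP v (Lsym j.val l.val)).det)) :
    BPEA.PolyTimeReducible (PEA 3) := by
  obtain ⟨f, hf, hfr⟩ := codeFP_compileRaw
  have hred : ∀ I : BPEAInst, f (BPEAInst.encoding.encode I) = PEAInst.encoding.encode (compileInst I) := by
    intro I
    rw [compile_encode_eq_bpeaE, RandPoly.encode_eq_instE, hfr, rawOf_compileInst]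
  refine ⟨f, hf, fun w hw => ?_, fun w hw => ?_⟩
  · have hw' := hw
    obtain ⟨I, -, rfl⟩ : ∃ I, I ∈ _ ∧ BPEAInst.encoding.encode I = w := hw
    rw [hred]
    exact compileInst_mem_yes hblock hw'
  · have hw' := hw
    obtain ⟨I, -, rfl⟩ : ∃ I, I ∈ _ ∧ BPEAInst.encoding.encode I = w := hw
    rw [hred]
    exact compileInst_mem_no hblock hw'

end Summit.PneNP.PneNP.Cruxes.PeaWorstToAvg.DualModeCompile
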